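import Summits.MatrixMultiplication.OmegaCensus.ThreeSetZ5Z5PlaneCertificate
import HarnessLib

/-!
# Plane (`ℤ₅ × ℤ₅`) row certificates for the DOMINO identity (`W = {0}`): refutation and pinning

ω-census `pub-omega`, family (b3), seat pub-omega-group gen 37.  Framing: lottery ticket; floor = certified bounds/negative
ranges.  VALUE: kernel infrastructure for the `ℤ₅²`-stage of the census cell `(1,9,12)@325` of `ℤ₅ × ℤ₆₅` (domino shape; design
`HOME/pub-omega-group-g37/DESIGN-1-9-12.md`: all plane matrices nonsingular, two rigid survivors); NOT progress on ω.

The `W = {0}` twin of `ThreeSetZ5Z5PlaneCertificate.lean` (gen 37): plane matrix `M(t,u) = F(t−u) + F(u−t) + F(t+u)` (`planeMat1`, pure-`ℕ`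
twin `pmNat1`, per-`F` bridge `bridgeOK1`), row check `rowOK1`, pairing `mul_eq_of_rowOK1` (`N·G(u₀) = 13·Σy − y(σ)`), refutation
`false_of_refuteRowOK1`, pinning `eq_of_pinRowsOK1`, and `double_sum_eq_planeMat1` (fibre counts of `W` = indicator of `0`).  Integer rows in
the shifted-`ℕ` encoding `zrow` / `zrows` of the three-set file.
-/

namespace Summit.MatrixMultiplication.OmegaCensus

namespace Z5Z5ThreeSet

open Finset ZpZpDomino

/-- The DOMINO plane matrix (`W = {0}`): `M(t,u) = F(t−u) + F(u−t) + F(t+u)`. [folklore] -/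
def planeMat1 (F : List ℕ) (t u : ZMod 5 × ZMod 5) : ℕ := gridFn F (t - u) + gridFn F (u - t) + gridFn F (t + u)

/-- Pure-`ℕ` twin of `planeMat1` on point indices. [folklore] -/
def pmNat1 (F : List ℕ) (ti ui : ℕ) : ℕ :=
  F.getD (pI ((ti / 5 + 5 - ui / 5) % 5) ((ti % 5 + 5 - ui % 5) % 5)) 0 +
  F.getD (pI ((ui / 5 + 5 - ti / 5) % 5) ((ui % 5 + 5 - ti % 5) % 5)) 0 +
  F.getD (pI ((ti / 5 + ui / 5) % 5) ((ti % 5 + ui % 5) % 5)) 0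

/-- **Bridge check** (decided per `F`): `planeMat1 F` agrees with `pmNat1 F` on all `625` index pairs. [folklore] -/
def bridgeOK1 (F : List ℕ) : Bool :=
  (List.range 25).all fun ti => (List.range 25).all fun ui => planeMat1 F (pt 5 ti) (pt 5 ui) == pmNat1 F ti ui

/-- **Row certificate check** (domino): `Σ_t y(t)·M(t,u) = N·[u = u₀]` for every `u < 25`. [folklore] -/
def rowOK1 (F : List ℕ) (y : List ℤ) (N u₀ : ℕ) : Bool :=
  (List.range 25).all fun ui =>
    ((List.range 25).map fun ti => y.getD ti 0 * (pmNat1 F ti ui : ℤ)).sum == (if ui = u₀ then (N : ℤ) else 0)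

/-- Refutation certificate (domino, bridge supplied separately). [folklore] -/
def refuteRowOK1 (F : List ℕ) (σ : ℕ) (c : ℕ × ℕ × List ℤ) : Bool :=
  rowOK1 F c.2.2 c.2.1 c.1 && (decide (rowRHS c.2.2 σ < 0) || rowRHS c.2.2 σ % (c.2.1 : ℤ) != 0)

/-- One row of a pinning certificate (domino). [folklore] -/
def pinRowOK1 (F : List ℕ) (σ : ℕ) (h : List ℕ) (rows : List (ℕ × List ℤ)) (u₀ : ℕ) : Bool :=
  rowOK1 F (rows.getD u₀ (0, [])).2 (rows.getD u₀ (0, [])).1 u₀ && decide (0 < (rows.getD u₀ (0, [])).1) &&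
    (rowRHS (rows.getD u₀ (0, [])).2 σ == ((rows.getD u₀ (0, [])).1 : ℤ) * (h.getD u₀ 0 : ℤ))

/-- Pinning certificate (domino, bridge supplied separately): a certified row for every `u₀ < 25`. [folklore] -/
def pinRowsOK1 (F : List ℕ) (σ : ℕ) (h : List ℕ) (rows : List (ℕ × List ℤ)) : Bool :=
  (List.range 25).all (pinRowOK1 F σ h rows)

/-! ## Semantics -/

/-- Reading `bridgeOK1`. [folklore] -/
theorem planeMat1_eq_pmNat1 {F : List ℕ} (h : bridgeOK1 F = true) (t u : ZMod 5 × ZMod 5) :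
    planeMat1 F t u = pmNat1 F (ptIdx 5 t) (ptIdx 5 u) := by
  simp only [bridgeOK1, List.all_eq_true, List.mem_range, beq_iff_eq] at h
  have := h (ptIdx 5 t) (ptIdx_lt 5 t) (ptIdx 5 u) (ptIdx_lt 5 u)
  rwa [pt_ptIdx, pt_ptIdx] at this

/-- **Pairing the plane identity with a certified row**: `N·G(pt u₀) = 13·Σy − y(σ)`. [folklore] -/
theorem mul_eq_of_rowOK1 {F : List ℕ} {y : List ℤ} {N u₀ : ℕ} (hb : bridgeOK1 F = true) (hrow : rowOK1 F y N u₀ = true)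
    (hu₀ : u₀ < 25) (G : ZMod 5 × ZMod 5 → ℕ) {σ : ℕ} (hσ : σ < 25)
    (hid : ∀ t : ZMod 5 × ZMod 5, (∑ u : ZMod 5 × ZMod 5, planeMat1 F t u * G u) + (if pt 5 σ = t then 1 else 0) = 13) :
    (N : ℤ) * (G (pt 5 u₀) : ℤ) = rowRHS y σ := by
  simp only [rowOK1, List.all_eq_true, List.mem_range, beq_iff_eq] at hrow
  -- the column relation as a statement over `ZMod 5 × ZMod 5`
  have hcol : ∀ u : ZMod 5 × ZMod 5, ∑ t : ZMod 5 × ZMod 5, y.getD (ptIdx 5 t) 0 * (planeMat1 F t u : ℤ) =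
      if u = pt 5 u₀ then (N : ℤ) else 0 := by
    intro u
    have h1 := hrow (ptIdx 5 u) (ptIdx_lt 5 u)
    rw [sum_eq_list_sum]
    have e : ((List.range 25).map fun i => y.getD (ptIdx 5 (pt 5 i)) 0 * (planeMat1 F (pt 5 i) u : ℤ)) =
        (List.range 25).map fun ti => y.getD ti 0 * (pmNat1 F ti (ptIdx 5 u) : ℤ) := by
      refine List.map_congr_left fun i hi => ?_
      rw [List.mem_range] at hi
      rw [ptIdx_pt 5 hi, planeMat1_eq_pmNat1 hb, ptIdx_pt 5 hi]
    rw [e, h1]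
    by_cases hu : u = pt 5 u₀
    · rw [if_pos hu, if_pos (by rw [hu, ptIdx_pt 5 hu₀])]
    · rw [if_neg hu, if_neg (fun e' => hu (by rw [← e', pt_ptIdx]))]
  -- pair the identity with `y`
  have hpair : ∑ t : ZMod 5 × ZMod 5, y.getD (ptIdx 5 t) 0 *
      (((∑ u : ZMod 5 × ZMod 5, planeMat1 F t u * G u) + (if pt 5 σ = t then 1 else 0) : ℕ) : ℤ) =
      ∑ t : ZMod 5 × ZMod 5, y.getD (ptIdx 5 t) 0 * (13 : ℤ) := sum_congr rfl fun t _ => by rw [hid t]; rfl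
  have lhs : ∑ t : ZMod 5 × ZMod 5, y.getD (ptIdx 5 t) 0 *
      (((∑ u : ZMod 5 × ZMod 5, planeMat1 F t u * G u) + (if pt 5 σ = t then 1 else 0) : ℕ) : ℤ) =
      (∑ u : ZMod 5 × ZMod 5, (G u : ℤ) * ∑ t : ZMod 5 × ZMod 5, y.getD (ptIdx 5 t) 0 * (planeMat1 F t u : ℤ)) +
        y.getD (ptIdx 5 (pt 5 σ)) 0 := by
    have e : ∀ t : ZMod 5 × ZMod 5, y.getD (ptIdx 5 t) 0 *
        (((∑ u : ZMod 5 × ZMod 5, planeMat1 F t u * G u) + (if pt 5 σ = t then 1 else 0) : ℕ) : ℤ) =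
        (∑ u : ZMod 5 × ZMod 5, y.getD (ptIdx 5 t) 0 * ((planeMat1 F t u : ℤ) * (G u : ℤ))) +
          (if pt 5 σ = t then y.getD (ptIdx 5 t) 0 else 0) := by
      intro t
      push_cast
      rw [mul_add, mul_sum]
      congr 1
      split_ifs <;> simp
    rw [sum_congr rfl fun t _ => e t, sum_add_distrib, sum_ite_eq, if_pos (mem_univ _), sum_comm]
    congr 1
    refine sum_congr rfl fun u _ => ?_
    rw [mul_sum]
    exact sum_congr rfl fun t _ => by ring
  rw [lhs] at hpair
  simp only [hcol, mul_ite, mul_zero, sum_ite_eq', mem_univ, if_true] at hpair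
  rw [ptIdx_pt 5 hσ] at hpair
  have hrhs : ∑ t : ZMod 5 × ZMod 5, y.getD (ptIdx 5 t) 0 * (13 : ℤ) =
      13 * ((List.range 25).map fun ti => y.getD ti 0).sum := by
    have e' : ((List.range 25).map fun i => y.getD (ptIdx 5 (pt 5 i)) 0) = (List.range 25).map fun ti => y.getD ti 0 :=
      List.map_congr_left fun i hi => by rw [List.mem_range] at hi; rw [ptIdx_pt 5 hi]
    rw [← sum_mul, mul_comm, sum_eq_list_sum (fun t => y.getD (ptIdx 5 t) 0), e']
  rw [hrhs] at hpair
  unfold rowRHS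
  linear_combination hpair

/-- **Soundness of the bridge-free refutation certificate.** [folklore] -/
theorem false_of_refuteRowOK1 {F : List ℕ} (hb : bridgeOK1 F = true) {σ : ℕ} (hσ : σ < 25) {c : ℕ × ℕ × List ℤ}
    (hc : refuteRowOK1 F σ c = true) (hu₀ : c.1 < 25) (G : ZMod 5 × ZMod 5 → ℕ)
    (hid : ∀ t : ZMod 5 × ZMod 5, (∑ u : ZMod 5 × ZMod 5, planeMat1 F t u * G u) + (if pt 5 σ = t then 1 else 0) = 13) :
    False := by
  rw [refuteRowOK1, Bool.and_eq_true, Bool.or_eq_true, decide_eq_true_eq, bne_iff_ne, ne_eq] at hc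
  obtain ⟨hrow, hbad⟩ := hc
  have key := mul_eq_of_rowOK1 hb hrow hu₀ G hσ hid
  rcases hbad with hneg | hdiv
  · have : (0 : ℤ) ≤ (c.2.1 : ℤ) * (G (pt 5 c.1) : ℤ) := by positivity
    linarith
  · exact hdiv (by rw [← key, Int.mul_emod_right])

/-- **Soundness of the bridge-free pinning certificate**: the plane identity with hole index `σ` forces `G = gridFn h`. [folklore] -/
theorem eq_of_pinRowsOK1 {F : List ℕ} (hb : bridgeOK1 F = true) {σ : ℕ} (hσ : σ < 25) {h : List ℕ} {rows : List (ℕ × List ℤ)}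
    (hc : pinRowsOK1 F σ h rows = true) (G : ZMod 5 × ZMod 5 → ℕ)
    (hid : ∀ t : ZMod 5 × ZMod 5, (∑ u : ZMod 5 × ZMod 5, planeMat1 F t u * G u) + (if pt 5 σ = t then 1 else 0) = 13)
    (u : ZMod 5 × ZMod 5) : G u = gridFn h u := by
  rw [pinRowsOK1, List.all_eq_true] at hc
  have h1 := hc (ptIdx 5 u) (List.mem_range.2 (ptIdx_lt 5 u))
  rw [pinRowOK1, Bool.and_eq_true, Bool.and_eq_true, decide_eq_true_eq, beq_iff_eq] at h1
  obtain ⟨⟨hrow, hN⟩, hval⟩ := h1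
  have key := mul_eq_of_rowOK1 hb hrow (ptIdx_lt 5 u) G hσ hid
  rw [pt_ptIdx, hval] at key
  unfold gridFn
  have hN' : ((rows.getD (ptIdx 5 u) (0, [])).1 : ℤ) ≠ 0 := by exact_mod_cast hN.ne'
  exact_mod_cast mul_left_cancel₀ hN' key

/-- The inner double sum of the plane identity for `W` with fibre counts the indicator of `0` and `X` with fibre counts `gridFn F` is
`Σ_u planeMat1 F t u · G u`. [folklore] -/
theorem double_sum_eq_planeMat1 (Wc Xc G : ZMod 5 × ZMod 5 → ℕ) (F : List ℕ)
    (hW1 : Wc 0 = 1) (hW0 : ∀ v, v ≠ 0 → Wc v = 0) (hX : ∀ v, Xc v = gridFn F v) (t : ZMod 5 × ZMod 5) :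
    (∑ u : ZMod 5 × ZMod 5, ∑ v : ZMod 5 × ZMod 5, Wc v * (Xc (t - u + v) + Xc (v + u - t) + Xc (t + u - v)) * G u) =
      ∑ u : ZMod 5 × ZMod 5, planeMat1 F t u * G u := by
  have key : ∀ u : ZMod 5 × ZMod 5,
      (∑ v : ZMod 5 × ZMod 5, Wc v * (Xc (t - u + v) + Xc (v + u - t) + Xc (t + u - v))) = planeMat1 F t u := by
    intro u
    rw [Finset.sum_eq_single (0 : ZMod 5 × ZMod 5)]
    · rw [hW1, one_mul, add_zero, zero_add, sub_zero]
      simp only [planeMat1, hX]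
    · intro v _ hv; rw [hW0 v hv, zero_mul]
    · intro h; exact absurd (mem_univ _) h
  refine sum_congr rfl fun u _ => ?_
  rw [← sum_mul, key u]

/-! ## The bridge holds for every `F` (no per-instance check needed) -/

/-- `ptIdx` of a point in terms of the coordinates' values. [folklore] -/
theorem ptIdx_eq (w : ZMod 5 × ZMod 5) : ptIdx 5 w = pI w.1.val w.2.val := rfl

/-- Division and remainder of a point index. [folklore] -/
theorem ptIdx_div_mod (w : ZMod 5 × ZMod 5) : ptIdx 5 w / 5 = w.1.val ∧ ptIdx 5 w % 5 = w.2.val := by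
  have h2 := w.2.val_lt
  unfold ptIdx
  constructor
  · rw [show 5 * w.1.val + w.2.val = w.2.val + w.1.val * 5 by ring, Nat.add_mul_div_right _ _ (by norm_num),
      Nat.div_eq_of_lt h2, zero_add]
  · rw [show 5 * w.1.val + w.2.val = w.2.val + w.1.val * 5 by ring, Nat.add_mul_mod_self_right, Nat.mod_eq_of_lt h2]

/-- Values of differences and sums in `ZMod 5` (finite check). [folklore] -/
theorem val_sub_add_five : ∀ a b : ZMod 5, (a - b).val = (a.val + 5 - b.val) % 5 ∧ (a + b).val = (a.val + b.val) % 5 := by decide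

/-- **The domino plane bridge holds identically**: `planeMat1 F t u = pmNat1 F (ptIdx t) (ptIdx u)` for every `F`. [folklore] -/
theorem planeMat1_eq_pmNat1_all (F : List ℕ) (t u : ZMod 5 × ZMod 5) :
    planeMat1 F t u = pmNat1 F (ptIdx 5 t) (ptIdx 5 u) := by
  obtain ⟨ht1, ht2⟩ := ptIdx_div_mod t
  obtain ⟨hu1, hu2⟩ := ptIdx_div_mod u
  unfold planeMat1 pmNat1 gridFn
  rw [ht1, ht2, hu1, hu2, ptIdx_eq, ptIdx_eq, ptIdx_eq, Prod.fst_sub, Prod.snd_sub, Prod.fst_sub, Prod.snd_sub, Prod.fst_add,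
    Prod.snd_add, (val_sub_add_five t.1 u.1).1, (val_sub_add_five t.2 u.2).1, (val_sub_add_five u.1 t.1).1,
    (val_sub_add_five u.2 t.2).1, (val_sub_add_five t.1 u.1).2, (val_sub_add_five t.2 u.2).2]

/-- **`bridgeOK1` passes for every `F`.** [folklore] -/
theorem bridgeOK1_all (F : List ℕ) : bridgeOK1 F = true := by
  simp only [bridgeOK1, List.all_eq_true, List.mem_range, beq_iff_eq]
  intro ti hti ui hui
  rw [planeMat1_eq_pmNat1_all, ptIdx_pt 5 hti, ptIdx_pt 5 hui]

end Z5Z5ThreeSet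

end Summit.MatrixMultiplication.OmegaCensus
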